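import Summits.CriticalPhenomena.PercolationContinuityZ3.Theorems.PercNearOneGluingNoHeavyLowerTailSahiGridPattern
import Summits.CriticalPhenomena.PercolationContinuityZ3.Theorems.PercNearOneGluingNoHeavyLowerTailSahiTangentChain

/-!
# `NoHeavyLowerTail` (crux stmt-CriticalPhenomena-4575), Sahi programme: **THE TANGENT PATTERN FUNCTIONAL** — the order-3 tangent /
# contraction inequality `E₃^{B_p⊗μ}(F) ≥ p·E₃^{μ}(F|top)` on `d`-dimensional GRIDS × coin from ONE finite inequality per dimension,
# `TangentPatternPos d`, exactly as `PatternPos d` (`…SahiGridPattern`) does for Sahi's `C₃`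

Support file (Sahi cell, seat `prim-sahi-p1`, generation 47; `--supports stmt-CriticalPhenomena-4575`); part 6 of the tangent files.  Pure proofs
plus the bookkeeping DEFINITIONS `tker` (polarised kernel), `tangentForm` (its three-copy form), `sStarT` (pattern functional), `TsymT`
(symmetrised kernel) and the finite predicate `TangentPatternPos d` (an OBLIGATION, `@[conjecture]`, never used as a fact); no `sorry`, standard axioms.
Vocabulary of `…SahiGridPattern` (`Xd`, `Pd`, `Tmap`, `col`, `pb`, `sStarD`, `PatternPos`) and `…SahiTangentChain` (prim-sahi-p2 gen 32: the 14-term `T₃`,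
`sahiE_three_sections`).

THE MATHEMATICS.  The order-3 tangent functional of three pairs `b_l ≤ t_l` (sections of increasing functions of `Bool × Y`) under a weight on `Y` is the
expectation over three INDEPENDENT copies of the polarised kernel
  `K(x,y,z) = 2·b₀b₁b₂(x) + Σ_cyc [t_i(x)·t_jt_k(y) − b_i(x)·t_jt_k(y) − t_i(x)·b_jb_k(y)] − 2·t₀(x)t₁(y)t₂(z) + Σ_cyc b_i(x)t_j(y)t_k(z)`
(`tker`; value minus derivative of Sahi's kernel along `m ↦ pX + (1−p)Y`; `tker_self`: `K = hZ` when `B = T`): `tangentForm_eq_masses` identifies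
`tangentForm w T B = Σ_ω (∏w)·K` with the 14-term `T₃` of `…SahiTangentChain` in masses (`Z = 1`: `tangentExpr_eq_tangentForm`).  On a `d`-dimensional grid
`[K+1]^d` with a PRODUCT weight the generation-7 localisation applies verbatim: symmetrising over the re-indexings of the copies axis by axis
(`tangentForm_symm`) and sorting, `|S₃^d|·tangentForm = Σ_ω (∏w)·sStarT(pulled-back pairs)` with `sStarT T B = Σ_{π ∈ S₃^d} K(col π)` the kernel summed over
the `6^d` Latin patterns of `[3]^d` (`TsymT_eq_sStarT`, `TsymT_nonneg_of`).  Hence, with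
  `TangentPatternPos d :⟺ sStarT T B ≥ 0` for all triples of pairs `B_i ⊆ T_i` of up-sets of `[3]^d`,
* `tangentForm_gridProd_nonneg_of`: `TangentPatternPos d ⟹ T₃ ≥ 0` (homogeneous form) for every nonnegative product weight on every `d`-grid and all
  pairs of up-sets — `Z³·T₃` has nonnegative coefficients in the chain weights;  `patternPos_of_tangentPatternPos`: `TangentPatternPos d ⟹ PatternPos d` (`B = T`);
* **`sahiE_three_coin_grid_ge_of_tpp`**: `TangentPatternPos d ⟹ p·E₃^{μ}(χ_{U₁},χ_{V₁},χ_{W₁}) ≤ E₃^{B_p⊗μ}(F_U,F_V,F_W)` for every product probability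
  weight `μ` on `[K+1]^d`, `p ∈ [0,1]`, up-sets `U₀ ⊆ U₁, V₀ ⊆ V₁, W₀ ⊆ W₁` — through p2's sections identity `E₃^{B_p⊗μ} − p·c₃ = (1−p)[(1−p)c₀ + pT₃ + p(1−p)Πδ]`
  with `c₀ ≥ 0` from `PatternPos d`.
STATUS (cell prim-sahi, this seat, 2026-08-28; exact enumeration OUTSIDE Lean, code HOME/prim-sahi-p1/code/gen47/{tangent_pattern,tpp_check,kit_tpp}, kit j306089):
`TangentPatternPos 1` holds (all 1 000 configurations; cross-checked monomial by monomial against the symbolic `Z³T₃` on `[3]`), and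
**`TangentPatternPos 2` holds: all 908 600 unordered triples of the 175 pairs of up-sets of `[3]²`, minimum 0** — so Conjecture T₃ (memo
FROM-prim-sahi-p2-gen32-TANGENT) holds for every product weight on every two-dimensional grid × coin, the first class beyond chains; a Lean certificate
(`theorem tangentPatternPos_two : TangentPatternPos 2`, enumeration of the 20 up-sets of `[3]²` + `decide`/sliced certificates) is the successor's task.
`TangentPatternPos d` for `d ≥ 3` is OPEN and, via `PatternPos`, at least as strong as Kahn's conjecture for `∀ d`.  Nothing here asserts it. [this work]
-/

namespace Summit.CriticalPhenomena.PercolationContinuityZ3.Theorems.SahiTangent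

open Finset Literature.Probability.LatticeModels Literature.Combinatorics.Sahi2008
open SahiGrid3 (ind indR hZ indR_eq_cast indR_inter indR_univ mass_eq_sum_indR sum_copies_factor)
open SahiGridPattern (Xd Pd Tmap Tequiv weight_Tmap col pb ind_Tmap isUpperSet_pb PatternPos sStarD)
open scoped BigOperators

noncomputable section

/-! ### The polarised three-copy kernel of `T₃` -/

section Kernel

variable {Y : Type*} [DecidableEq Y]

/-- **The polarised (value − derivative) three-copy kernel of the tangent functional `T₃`.**  For three PAIRS of finite sets
`B_i ⊆ T_i` ("bottom" and "top" sections of an increasing function of `Bool × Y`):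
`K(x,y,z) = 2·b₀b₁b₂(x) + Σ_cyc [t_i(x)·t_jt_k(y) − b_i(x)·t_jt_k(y) − t_i(x)·b_jb_k(y)] − 2·t₀(x)t₁(y)t₂(z) + Σ_cyc b_i(x)t_j(y)t_k(z)`;
its expectation over three independent copies is the 14-term tangent expression `T₃` of `…SahiTangentChain` (memo FROM-prim-sahi-p2-gen32),
and for `B = T` it is Sahi's kernel `hZ` (`tker_self`). [this work] -/
def tker (T B : Fin 3 → Finset Y) (x y z : Y) : ℤ :=
  2 * (ind (B 0) x * ind (B 1) x * ind (B 2) x)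
    + (ind (T 0) x * (ind (T 1) y * ind (T 2) y) + ind (T 1) x * (ind (T 0) y * ind (T 2) y) + ind (T 2) x * (ind (T 0) y * ind (T 1) y))
    - (ind (B 0) x * (ind (T 1) y * ind (T 2) y) + ind (B 1) x * (ind (T 0) y * ind (T 2) y) + ind (B 2) x * (ind (T 0) y * ind (T 1) y))
    - (ind (T 0) x * (ind (B 1) y * ind (B 2) y) + ind (T 1) x * (ind (B 0) y * ind (B 2) y) + ind (T 2) x * (ind (B 0) y * ind (B 1) y))
    - 2 * (ind (T 0) x * ind (T 1) y * ind (T 2) z)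
    + (ind (B 0) x * ind (T 1) y * ind (T 2) z + ind (T 0) x * ind (B 1) y * ind (T 2) z + ind (T 0) x * ind (T 1) y * ind (B 2) z)

/-- With equal tops and bottoms the polarised kernel is Sahi's three-copy kernel. [this work] -/
theorem tker_self (T : Fin 3 → Finset Y) (x y z : Y) : tker T T x y z = hZ (T 0) (T 1) (T 2) x y z := by
  unfold tker hZ; ring

/-- **The tangent form** of a weight `w` on a finite type and three pairs of sets: the polarised kernel summed over three independent
copies, `Σ_{ω ∈ Y³} (∏_c w(ω_c)) · K(ω₀,ω₁,ω₂)` — the homogeneous (degree-3) form of `T₃`; see `tangentForm_eq_masses`. [this work] -/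
def tangentForm [Fintype Y] (w : Y → ℝ) (T B : Fin 3 → Finset Y) : ℝ :=
  ∑ ω : Fin 3 → Y, (∏ c, w (ω c)) * (tker T B (ω 0) (ω 1) (ω 2) : ℝ)

/-- **The tangent form in masses**: with `Z = m(univ)`,
`tangentForm = 2Z²·m(B₀∩B₁∩B₂) + Z·Σ_cyc [m(T_i) − m(B_i)]·m(T_j∩T_k) − Z·Σ_cyc m(T_i)·m(B_j∩B_k) − 2·m(T₀)m(T₁)m(T₂) + Σ_cyc m(B_i)m(T_j)m(T_k)`
(for a probability weight, `Z = 1`, this is the 14-term `T₃` of `…SahiTangentChain`). [this work] -/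
theorem tangentForm_eq_masses [Fintype Y] (w : Y → ℝ) (T B : Fin 3 → Finset Y) :
    tangentForm w T B =
      2 * mass w univ ^ 2 * mass w (B 0 ∩ B 1 ∩ B 2)
      + mass w univ * ((mass w (T 0) - mass w (B 0)) * mass w (T 1 ∩ T 2) + (mass w (T 1) - mass w (B 1)) * mass w (T 0 ∩ T 2)
          + (mass w (T 2) - mass w (B 2)) * mass w (T 0 ∩ T 1))
      - mass w univ * (mass w (T 0) * mass w (B 1 ∩ B 2) + mass w (T 1) * mass w (B 0 ∩ B 2) + mass w (T 2) * mass w (B 0 ∩ B 1))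
      - 2 * (mass w (T 0) * mass w (T 1) * mass w (T 2))
      + (mass w (B 0) * mass w (T 1) * mass w (T 2) + mass w (T 0) * mass w (B 1) * mass w (T 2) + mass w (T 0) * mass w (T 1) * mass w (B 2)) := by
  set P : Y → ℝ := fun y => indR (B 0) y * indR (B 1) y * indR (B 2) y with hP
  set Q0 : Y → ℝ := fun y => indR (T 1) y * indR (T 2) y with hQ0
  set Q1 : Y → ℝ := fun y => indR (T 0) y * indR (T 2) y with hQ1
  set Q2 : Y → ℝ := fun y => indR (T 0) y * indR (T 1) y with hQ2
  set R0 : Y → ℝ := fun y => indR (B 1) y * indR (B 2) y with hR0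
  set R1 : Y → ℝ := fun y => indR (B 0) y * indR (B 2) y with hR1
  set R2 : Y → ℝ := fun y => indR (B 0) y * indR (B 1) y with hR2
  set O : Y → ℝ := fun _ => 1 with hO
  have hcast : ∀ ω : Fin 3 → Y, (∏ c, w (ω c)) * (tker T B (ω 0) (ω 1) (ω 2) : ℝ) =
      2 * ((∏ c, w (ω c)) * (P (ω 0) * O (ω 1) * O (ω 2)))
      + ((∏ c, w (ω c)) * (indR (T 0) (ω 0) * Q0 (ω 1) * O (ω 2))
        + (∏ c, w (ω c)) * (indR (T 1) (ω 0) * Q1 (ω 1) * O (ω 2))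
        + (∏ c, w (ω c)) * (indR (T 2) (ω 0) * Q2 (ω 1) * O (ω 2)))
      - ((∏ c, w (ω c)) * (indR (B 0) (ω 0) * Q0 (ω 1) * O (ω 2))
        + (∏ c, w (ω c)) * (indR (B 1) (ω 0) * Q1 (ω 1) * O (ω 2))
        + (∏ c, w (ω c)) * (indR (B 2) (ω 0) * Q2 (ω 1) * O (ω 2)))
      - ((∏ c, w (ω c)) * (indR (T 0) (ω 0) * R0 (ω 1) * O (ω 2))
        + (∏ c, w (ω c)) * (indR (T 1) (ω 0) * R1 (ω 1) * O (ω 2))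
        + (∏ c, w (ω c)) * (indR (T 2) (ω 0) * R2 (ω 1) * O (ω 2)))
      - 2 * ((∏ c, w (ω c)) * (indR (T 0) (ω 0) * indR (T 1) (ω 1) * indR (T 2) (ω 2)))
      + ((∏ c, w (ω c)) * (indR (B 0) (ω 0) * indR (T 1) (ω 1) * indR (T 2) (ω 2))
        + (∏ c, w (ω c)) * (indR (T 0) (ω 0) * indR (B 1) (ω 1) * indR (T 2) (ω 2))
        + (∏ c, w (ω c)) * (indR (T 0) (ω 0) * indR (T 1) (ω 1) * indR (B 2) (ω 2))) := by
    intro ω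
    simp only [hP, hQ0, hQ1, hQ2, hR0, hR1, hR2, hO]
    unfold tker
    push_cast
    simp only [indR_eq_cast]
    ring
  unfold tangentForm
  rw [Finset.sum_congr rfl fun ω _ => hcast ω]
  simp only [Finset.sum_add_distrib, Finset.sum_sub_distrib, ← Finset.mul_sum, sum_copies_factor]
  simp only [hP, hQ0, hQ1, hQ2, hR0, hR1, hR2, hO, mass_eq_sum_indR, indR_inter, indR_univ, mul_one, mul_comm, mul_left_comm,
    mul_assoc]
  ring

end Kernel

/-! ### The tangent pattern functional on the small cube `[3]^d` and the predicate `TangentPatternPos d` -/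

section Pattern

variable {d K : ℕ}

/-- **`sStarT`**: the polarised kernel summed over the `6^d` permutation patterns of `[3]^d` (three pairs `B_i ⊆ T_i ⊆ [3]^d`). [this work] -/
def sStarT (T B : Fin 3 → Finset (Pd d)) : ℤ :=
  ∑ π : Fin d → Equiv.Perm (Fin 3), tker T B (col π 0) (col π 1) (col π 2)

/-- With equal tops and bottoms, `sStarT` is the pattern functional `sStarD` of `…SahiGridPattern`. [this work] -/
theorem sStarT_self (T : Fin 3 → Finset (Pd d)) : sStarT T T = sStarD (T 0) (T 1) (T 2) := by
  unfold sStarT sStarD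
  exact Finset.sum_congr rfl fun π _ => tker_self T _ _ _

/-- **`TangentPatternPos d`** — THE TANGENT PATTERN INEQUALITY ON `[3]^d`: `sStarT T B ≥ 0` for all triples of pairs `B_i ⊆ T_i` of
up-sets of `[3]^d` (equivalently: the order-3 tangent functional `T₃` of pairs of up-set indicators is nonnegative under three-point LATIN
HYPERCUBE sampling of `[3]^d`; equivalently: `Z³·T₃` on `d`-dimensional grids × coin with product weights has nonnegative coefficients in the
chain weights).  STATUS: `d = 1` (1 000 configurations) and `d = 2` (all 908 600 unordered triples of the 175 pairs of up-sets of `[3]²`)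
hold by exact enumeration OUTSIDE Lean (cell prim-sahi, seat prim-sahi-p1 gen 47, kit j306089); OPEN for `d ≥ 3`; it implies `PatternPos d`
(`patternPos_of_tangentPatternPos`), so `∀ d` it is at least as strong as Kahn's conjecture.  An obligation / hypothesis, never a fact.
[this work] [status: checked by computation for d ≤ 2 (not in Lean); open for d ≥ 3] -/
@[conjecture] def TangentPatternPos (d : ℕ) : Prop :=
  ∀ T B : Fin 3 → Finset (Pd d), (∀ i, IsUpperSet (T i : Set (Pd d))) → (∀ i, IsUpperSet (B i : Set (Pd d))) → (∀ i, B i ⊆ T i) →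
    0 ≤ sStarT T B

/-- `TangentPatternPos d ⟹ PatternPos d` (take `B = T`). [this work] -/
theorem patternPos_of_tangentPatternPos (h : TangentPatternPos d) : PatternPos d := by
  intro A₀ A₁ A₂ h₀ h₁ h₂
  have key := h ![A₀, A₁, A₂] ![A₀, A₁, A₂] (fun i => by fin_cases i <;> assumption) (fun i => by fin_cases i <;> assumption)
    (fun i => subset_refl _)
  rw [sStarT_self] at key
  exact key

/-- The symmetrised polarised kernel `Σ_{π ∈ S₃^d} K(T_π ω)` of three grid copies. [this work] -/
def TsymT (T B : Fin 3 → Finset (Xd d K)) (ω : Fin 3 → Xd d K) : ℤ :=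
  ∑ π : Fin d → Equiv.Perm (Fin 3), tker T B (Tmap π ω 0) (Tmap π ω 1) (Tmap π ω 2)

/-- **Symmetrisation**: `|S₃^d| · tangentForm = Σ_ω (∏ w) · TsymT(ω)` for a product weight on the grid `[K+1]^d`. [this work] -/
theorem tangentForm_symm (g : Fin d → Fin (K + 1) → ℝ) (T B : Fin 3 → Finset (Xd d K)) :
    (Fintype.card (Fin d → Equiv.Perm (Fin 3)) : ℝ) * tangentForm (fun ω : Xd d K => ∏ a, g a (ω a)) T B =
      ∑ ω : Fin 3 → Xd d K, (∏ c, ∏ a, g a (ω c a)) * (TsymT T B ω : ℝ) := by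
  have hπ : ∀ π : Fin d → Equiv.Perm (Fin 3), tangentForm (fun ω : Xd d K => ∏ a, g a (ω a)) T B =
      ∑ ω : Fin 3 → Xd d K, (∏ c, ∏ a, g a (ω c a)) * (tker T B (Tmap π ω 0) (Tmap π ω 1) (Tmap π ω 2) : ℝ) := by
    intro π
    unfold tangentForm
    rw [← Equiv.sum_comp (Tequiv π)]
    refine Finset.sum_congr rfl fun ω _ => ?_
    show (∏ c, ∏ a, g a (Tmap π ω c a)) * _ = _
    rw [weight_Tmap]
    rfl
  rw [← nsmul_eq_mul, ← Finset.card_univ, ← Finset.sum_const, Finset.sum_congr rfl fun π _ => hπ π, Finset.sum_comm]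
  refine Finset.sum_congr rfl fun ω _ => ?_
  rw [← Finset.mul_sum]
  unfold TsymT
  push_cast
  rfl

/-- Pulled-back pairs: `TsymT(ω) = sStarT (pb ω T) (pb ω B)`. [this work] -/
theorem TsymT_eq_sStarT (T B : Fin 3 → Finset (Xd d K)) (ω : Fin 3 → Xd d K) :
    TsymT T B ω = sStarT (fun i => pb ω (T i)) (fun i => pb ω (B i)) := by
  unfold TsymT sStarT
  refine Finset.sum_congr rfl fun π _ => ?_
  unfold tker
  simp only [ind_Tmap]

/-- Composing with fixed permutations axis by axis does not change `TsymT`. [this work] -/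
theorem TsymT_Tmap (T B : Fin 3 → Finset (Xd d K)) (σ : Fin d → Equiv.Perm (Fin 3)) (ω : Fin 3 → Xd d K) :
    TsymT T B (Tmap σ ω) = TsymT T B ω := by
  unfold TsymT
  have h : ∀ π : Fin d → Equiv.Perm (Fin 3), Tmap π (Tmap σ ω) = Tmap (fun a => (π a).trans (σ a)) ω := by
    intro π; funext c a; rfl
  simp_rw [h]
  exact Fintype.sum_equiv (Equiv.piCongrRight fun a => Equiv.mulLeft (σ a)) _ _ fun π => rfl

/-- **`TsymT(ω) ≥ 0`** for pairs of up-sets, GIVEN the tangent pattern inequality in dimension `d`: sort, pull back, apply it. [this work] -/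
theorem TsymT_nonneg_of (hP : TangentPatternPos d) {T B : Fin 3 → Finset (Xd d K)} (hT : ∀ i, IsUpperSet (T i : Set (Xd d K)))
    (hB : ∀ i, IsUpperSet (B i : Set (Xd d K))) (hBT : ∀ i, B i ⊆ T i) (ω : Fin 3 → Xd d K) : 0 ≤ TsymT T B ω := by
  let σ : Fin d → Equiv.Perm (Fin 3) := fun a => Tuple.sort fun c => ω c a
  have hsort : ∀ a, Monotone fun c => Tmap σ ω c a := fun a => by
    show Monotone ((fun c => ω c a) ∘ σ a)
    exact Tuple.monotone_sort _
  rw [← TsymT_Tmap T B σ ω, TsymT_eq_sStarT]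
  refine hP _ _ (fun i => isUpperSet_pb hsort (hT i)) (fun i => isUpperSet_pb hsort (hB i)) (fun i => ?_)
  intro q hq
  unfold pb at hq ⊢
  rw [mem_filter] at hq ⊢
  exact ⟨hq.1, hBT i hq.2⟩

/-- **`TangentPatternPos d ⟹` the tangent form is nonnegative on every `d`-dimensional grid**, for every nonnegative product weight and all
triples of pairs of up-sets. [this work] -/
theorem tangentForm_gridProd_nonneg_of (hP : TangentPatternPos d) (g : Fin d → Fin (K + 1) → ℝ) (hg : ∀ a u, 0 ≤ g a u)
    {T B : Fin 3 → Finset (Xd d K)} (hT : ∀ i, IsUpperSet (T i : Set (Xd d K))) (hB : ∀ i, IsUpperSet (B i : Set (Xd d K)))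
    (hBT : ∀ i, B i ⊆ T i) : 0 ≤ tangentForm (fun ω : Xd d K => ∏ a, g a (ω a)) T B := by
  have hcard : (0 : ℝ) < Fintype.card (Fin d → Equiv.Perm (Fin 3)) := by exact_mod_cast Fintype.card_pos
  have h := tangentForm_symm g T B
  have hsum : 0 ≤ ∑ ω : Fin 3 → Xd d K, (∏ c, ∏ a, g a (ω c a)) * (TsymT T B ω : ℝ) :=
    Finset.sum_nonneg fun ω _ => mul_nonneg (Finset.prod_nonneg fun c _ => Finset.prod_nonneg fun a _ => hg a _)
      (by exact_mod_cast TsymT_nonneg_of hP hT hB hBT ω)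
  rw [← h] at hsum
  exact (mul_nonneg_iff_of_pos_left hcard).1 hsum

end Pattern

/-! ### From the pattern inequality to the contraction inequality `E₃ ≥ p·E₃(·|top)` on `d`-dimensional grids × coin -/

section Grid

variable {d K : ℕ}

/-- The 14-term tangent expression `T₃` of `…SahiTangentChain` (one weight) is the tangent form at `Z = 1`. [this work] -/
theorem tangentExpr_eq_tangentForm {Y : Type*} [Fintype Y] [DecidableEq Y] {μ : Y → ℝ} (hμ₁ : ∑ x, μ x = 1)
    (U₀ U₁ V₀ V₁ W₀ W₁ : Finset Y) :
    2 * ex μ (setInd U₀ * setInd V₀ * setInd W₀)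
        + (ex μ (setInd U₁) - ex μ (setInd U₀)) * ex μ (setInd V₁ * setInd W₁)
        + (ex μ (setInd V₁) - ex μ (setInd V₀)) * ex μ (setInd U₁ * setInd W₁)
        + (ex μ (setInd W₁) - ex μ (setInd W₀)) * ex μ (setInd U₁ * setInd V₁)
        + ex μ (setInd U₀) * ex μ (setInd V₁) * ex μ (setInd W₁) + ex μ (setInd V₀) * ex μ (setInd U₁) * ex μ (setInd W₁)
        + ex μ (setInd W₀) * ex μ (setInd U₁) * ex μ (setInd V₁)
        - ex μ (setInd U₁) * ex μ (setInd V₀ * setInd W₀) - ex μ (setInd V₁) * ex μ (setInd U₀ * setInd W₀)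
        - ex μ (setInd W₁) * ex μ (setInd U₀ * setInd V₀)
        - 2 * ex μ (setInd U₁) * ex μ (setInd V₁) * ex μ (setInd W₁)
      = tangentForm μ ![U₁, V₁, W₁] ![U₀, V₀, W₀] := by
  have exm : ∀ A : Finset Y, ex μ (setInd A) = mass μ A := fun A => sum_mul_indicator_eq_mass μ A
  have hZ : mass μ univ = 1 := by rw [mass_univ]; exact hμ₁
  simp only [setInd_mul, exm]
  rw [tangentForm_eq_masses, hZ]
  simp only [Matrix.cons_val_zero, Matrix.cons_val_one, Matrix.cons_val_two, Matrix.head_cons, Matrix.tail_cons]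
  ring

/-- **`TangentPatternPos d ⟹ T₃ ≥ 0` on every `d`-dimensional grid** for every nonnegative product probability weight and up-sets
`U₀ ⊆ U₁`, `V₀ ⊆ V₁`, `W₀ ⊆ W₁` (in the 14-term form of `…SahiTangentChain`). [this work] -/
theorem tangentExpr_nonneg_grid_of_tpp (hP : TangentPatternPos d) (g : Fin d → Fin (K + 1) → ℝ) (hg0 : ∀ a u, 0 ≤ g a u)
    (hg1 : ∀ a, ∑ u, g a u = 1) {U₀ U₁ V₀ V₁ W₀ W₁ : Finset (Xd d K)}
    (hU₀ : IsUpperSet (U₀ : Set (Xd d K))) (hU₁ : IsUpperSet (U₁ : Set (Xd d K))) (hV₀ : IsUpperSet (V₀ : Set (Xd d K)))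
    (hV₁ : IsUpperSet (V₁ : Set (Xd d K))) (hW₀ : IsUpperSet (W₀ : Set (Xd d K))) (hW₁ : IsUpperSet (W₁ : Set (Xd d K)))
    (hU : U₀ ⊆ U₁) (hV : V₀ ⊆ V₁) (hW : W₀ ⊆ W₁) :
    0 ≤ 2 * ex (fun ω : Xd d K => ∏ a, g a (ω a)) (setInd U₀ * setInd V₀ * setInd W₀)
        + (ex (fun ω : Xd d K => ∏ a, g a (ω a)) (setInd U₁) - ex (fun ω : Xd d K => ∏ a, g a (ω a)) (setInd U₀))
            * ex (fun ω : Xd d K => ∏ a, g a (ω a)) (setInd V₁ * setInd W₁)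
        + (ex (fun ω : Xd d K => ∏ a, g a (ω a)) (setInd V₁) - ex (fun ω : Xd d K => ∏ a, g a (ω a)) (setInd V₀))
            * ex (fun ω : Xd d K => ∏ a, g a (ω a)) (setInd U₁ * setInd W₁)
        + (ex (fun ω : Xd d K => ∏ a, g a (ω a)) (setInd W₁) - ex (fun ω : Xd d K => ∏ a, g a (ω a)) (setInd W₀))
            * ex (fun ω : Xd d K => ∏ a, g a (ω a)) (setInd U₁ * setInd V₁)
        + ex (fun ω : Xd d K => ∏ a, g a (ω a)) (setInd U₀) * ex (fun ω : Xd d K => ∏ a, g a (ω a)) (setInd V₁)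
            * ex (fun ω : Xd d K => ∏ a, g a (ω a)) (setInd W₁)
        + ex (fun ω : Xd d K => ∏ a, g a (ω a)) (setInd V₀) * ex (fun ω : Xd d K => ∏ a, g a (ω a)) (setInd U₁)
            * ex (fun ω : Xd d K => ∏ a, g a (ω a)) (setInd W₁)
        + ex (fun ω : Xd d K => ∏ a, g a (ω a)) (setInd W₀) * ex (fun ω : Xd d K => ∏ a, g a (ω a)) (setInd U₁)
            * ex (fun ω : Xd d K => ∏ a, g a (ω a)) (setInd V₁)
        - ex (fun ω : Xd d K => ∏ a, g a (ω a)) (setInd U₁) * ex (fun ω : Xd d K => ∏ a, g a (ω a)) (setInd V₀ * setInd W₀)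
        - ex (fun ω : Xd d K => ∏ a, g a (ω a)) (setInd V₁) * ex (fun ω : Xd d K => ∏ a, g a (ω a)) (setInd U₀ * setInd W₀)
        - ex (fun ω : Xd d K => ∏ a, g a (ω a)) (setInd W₁) * ex (fun ω : Xd d K => ∏ a, g a (ω a)) (setInd U₀ * setInd V₀)
        - 2 * ex (fun ω : Xd d K => ∏ a, g a (ω a)) (setInd U₁) * ex (fun ω : Xd d K => ∏ a, g a (ω a)) (setInd V₁)
            * ex (fun ω : Xd d K => ∏ a, g a (ω a)) (setInd W₁) := by
  have hsum : ∑ ω : Xd d K, ∏ a, g a (ω a) = 1 := by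
    rw [← Fintype.prod_sum]; simp [hg1]
  rw [tangentExpr_eq_tangentForm hsum]
  refine tangentForm_gridProd_nonneg_of hP g hg0 (fun i => ?_) (fun i => ?_) (fun i => ?_)
  · fin_cases i <;> assumption
  · fin_cases i <;> assumption
  · fin_cases i <;> assumption

/-- **`TangentPatternPos d ⟹` THE CONTRACTION INEQUALITY ON EVERY `d`-DIMENSIONAL GRID × COIN** (product weights).  For nonnegative
probability chain weights `g_a` on the axes of `[K+1]^d`, `μ = ⊗ g_a`, `p ∈ [0,1]` and up-sets `U₀ ⊆ U₁`, `V₀ ⊆ V₁`, `W₀ ⊆ W₁` of the grid: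
`p · E₃^{μ}(χ_{U₁},χ_{V₁},χ_{W₁}) ≤ E₃^{B_p⊗μ}(F_U,F_V,F_W)` — via the sections identity of `…SahiTangentChain`, `T₃ ≥ 0`
(`tangentExpr_nonneg_grid_of_tpp`), `E₃(bottoms) ≥ 0` (`PatternPos d`, implied by `TangentPatternPos d`) and `Πδ ≥ 0`.  With `TangentPatternPos 2` (checked
outside Lean) this is Conjecture T₃ for every product weight on every two-dimensional grid × coin. [this work] -/
theorem sahiE_three_coin_grid_ge_of_tpp (hP : TangentPatternPos d) (g : Fin d → Fin (K + 1) → ℝ) (hg0 : ∀ a u, 0 ≤ g a u)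
    (hg1 : ∀ a, ∑ u, g a u = 1) {p : ℝ} (hp₀ : 0 ≤ p) (hp₁ : p ≤ 1) {U₀ U₁ V₀ V₁ W₀ W₁ : Finset (Xd d K)}
    (hU₀ : IsUpperSet (U₀ : Set (Xd d K))) (hU₁ : IsUpperSet (U₁ : Set (Xd d K))) (hV₀ : IsUpperSet (V₀ : Set (Xd d K)))
    (hV₁ : IsUpperSet (V₁ : Set (Xd d K))) (hW₀ : IsUpperSet (W₀ : Set (Xd d K))) (hW₁ : IsUpperSet (W₁ : Set (Xd d K)))
    (hU : U₀ ⊆ U₁) (hV : V₀ ⊆ V₁) (hW : W₀ ⊆ W₁) :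
    p * sahiE (fun ω : Xd d K => ∏ a, g a (ω a)) 3 ![setInd U₁, setInd V₁, setInd W₁] ≤
      sahiE (fun z : Bool × Xd d K => if z.1 then p * (∏ a, g a (z.2 a)) else (1 - p) * (∏ a, g a (z.2 a))) 3
        ![fun z => if z.1 then setInd U₁ z.2 else setInd U₀ z.2, fun z => if z.1 then setInd V₁ z.2 else setInd V₀ z.2,
          fun z => if z.1 then setInd W₁ z.2 else setInd W₀ z.2] := by
  set μ : Xd d K → ℝ := fun ω => ∏ a, g a (ω a) with hμ
  have hμ0 : ∀ ω, 0 ≤ μ ω := fun ω => Finset.prod_nonneg fun a _ => hg0 a _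
  have hμ1 : ∑ ω, μ ω = 1 := by rw [hμ, ← Fintype.prod_sum]; simp [hg1]
  have key := sahiE_three_sections μ μ p
    ![fun z => if z.1 then setInd U₁ z.2 else setInd U₀ z.2, fun z => if z.1 then setInd V₁ z.2 else setInd V₀ z.2,
      fun z => if z.1 then setInd W₁ z.2 else setInd W₀ z.2]
  simp only [Matrix.cons_val_zero, Matrix.cons_val_one, Matrix.cons_val_two, Matrix.head_cons, Matrix.tail_cons,
    if_true, if_false, Bool.false_eq_true] at key
  have hT := tangentExpr_nonneg_grid_of_tpp hP g hg0 hg1 hU₀ hU₁ hV₀ hV₁ hW₀ hW₁ hU hV hW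
  have hpos3 : SahiPositive μ 3 := SahiGridPattern.liebSahi_grid_of_patternPos (patternPos_of_tangentPatternPos hP) K g hg0 hg1
  have hc₀ : 0 ≤ sahiE μ 3 ![setInd U₀, setInd V₀, setInd W₀] :=
    hpos3 _ (fun i x => by fin_cases i <;> simp [setInd_nonneg]) (fun i => by
      fin_cases i
      · simpa using monotone_setInd hU₀
      · simpa using monotone_setInd hV₀
      · simpa using monotone_setInd hW₀)
  have hD : 0 ≤ (ex μ (setInd U₁) - ex μ (setInd U₀)) * (ex μ (setInd V₁) - ex μ (setInd V₀)) * (ex μ (setInd W₁) - ex μ (setInd W₀)) :=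
    mul_nonneg (mul_nonneg (sub_nonneg.2 (ex_setInd_mono hμ0 hU)) (sub_nonneg.2 (ex_setInd_mono hμ0 hV)))
      (sub_nonneg.2 (ex_setInd_mono hμ0 hW))
  have e0 : (fun x => setInd U₀ x) = setInd U₀ := rfl
  have e1 : (fun x => setInd U₁ x) = setInd U₁ := rfl
  have e2 : (fun x => setInd V₀ x) = setInd V₀ := rfl
  have e3 : (fun x => setInd V₁ x) = setInd V₁ := rfl
  have e4 : (fun x => setInd W₀ x) = setInd W₀ := rfl
  have e5 : (fun x => setInd W₁ x) = setInd W₁ := rfl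
  have m1 : (fun x => setInd U₀ x * setInd V₀ x * setInd W₀ x) = setInd U₀ * setInd V₀ * setInd W₀ := rfl
  have m2 : (fun x => setInd V₁ x * setInd W₁ x) = setInd V₁ * setInd W₁ := rfl
  have m3 : (fun x => setInd U₁ x * setInd W₁ x) = setInd U₁ * setInd W₁ := rfl
  have m4 : (fun x => setInd U₁ x * setInd V₁ x) = setInd U₁ * setInd V₁ := rfl
  have m5 : (fun x => setInd V₀ x * setInd W₀ x) = setInd V₀ * setInd W₀ := rfl
  have m6 : (fun x => setInd U₀ x * setInd W₀ x) = setInd U₀ * setInd W₀ := rfl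
  have m7 : (fun x => setInd U₀ x * setInd V₀ x) = setInd U₀ * setInd V₀ := rfl
  rw [e0, e1, e2, e3, e4, e5, m1, m2, m3, m4, m5, m6, m7] at key
  have h1p : 0 ≤ 1 - p := sub_nonneg.2 hp₁
  have hweight : (fun z : Bool × Xd d K => if z.1 then p * (∏ a, g a (z.2 a)) else (1 - p) * (∏ a, g a (z.2 a))) =
      fun z : Bool × Xd d K => if z.1 then p * μ z.2 else (1 - p) * μ z.2 := rfl
  rw [hweight]
  nlinarith [key, mul_nonneg h1p (mul_nonneg h1p hc₀), mul_nonneg h1p (mul_nonneg hp₀ hT),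
    mul_nonneg h1p (mul_nonneg (mul_nonneg hp₀ h1p) hD)]

end Grid

end

end Summit.CriticalPhenomena.PercolationContinuityZ3.Theorems.SahiTangent
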